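import Mathlib
import Summits.KontsevichZagierPeriods.Zeta5Search.LemmaDBonusTypes
import HarnessLib

/-!
# ζ(5) search — the STRUCTURAL GUARD of the collinearity criterion (census g17's rung O / X): definitions and combinatorics

Cell `pub-zeta5` (HONEST FRAMING: systematic search; no irrationality claim unless certified), typer seat generation 10; the definitions `ccRegime`,
`ccRegimeT`, `levelVec`, `sameKey`, `keyCount`, `ccLive`, `ccCount`, `ccGuard`, `ccGuardT` are census g17's (`xsave/g17/bc17/CCGuard.lean`, INBOX
2026-08-20T18:16Z, cross-checked there against the census's Python scan by 880 `#guard`s) VERBATIM, so that the census port and the tree agree by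
construction.  `ccCount b p N` = the number of ORBIT TYPES among the non-vanishing deep classes (keys `(centre flag, exponent vector)` up to reversal);
the guard asks `k ≤ 1` (line through the origin) or `N` odd, `k = 2` and the moment range (affine line).

Proved here (pure combinatorics): `sameKey` is an equivalence (`sameKey_refl/symm/trans`); `keyCount` counts a set of representatives
(`keyCount_cover`: a list `reps ⊆ l` of length `keyCount l` with every element of `l` `sameKey`-related to a representative); the exponent vector of a
level class `levelVec_level` (`= [netExp(x+kp)]_{k≤L}`, the `Finset.sort` form of `expVector_level`); membership in `ccLive`.
Part 2 (`CollinearityGuardProof.lean`) proves census's `CCOrbitTypeCorollary` and the rung-O/X licences.  Nothing here bears on irrationality.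
-/

open Finset

namespace Summit.KontsevichZagierPeriods.Zeta5Search.ClusterValuation

open Summit.KontsevichZagierPeriods.Zeta5Search.CasoratianValuation (InPolytope shift casoratian)
open Summit.KontsevichZagierPeriods.Zeta5Search.WedgeDictionary (dOf)
open Summit.KontsevichZagierPeriods.Zeta5Search.LevelClass (classSet_level level_injective)

/-! ## §1  Census g17's definitions (verbatim) -/

/-- The two regime hypotheses of `CollinearityCriterion` (H0 everywhere, `-N` attained by a multipole class), verbatim, as one Bool. -/
def ccRegime (b : ℕ → ℤ) (p N : ℕ) : Bool :=
  decide ((∀ x, x < p → -(N : ℤ) ≤ classExp b p x) ∧ (∃ x ∈ multipoleClasses b p, classExp b p x = -(N : ℤ)))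

/-- The two regime hypotheses of `CollinearityCriterionT` (classes deeper than `-N` are tame single-pole classes), verbatim, as one Bool. -/
def ccRegimeT (b : ℕ → ℤ) (p N : ℕ) : Bool :=
  decide ((∀ x, x < p → classExp b p x < -(N : ℤ) → classPoleCount b p x = 1 ∧ tameSingle b p x = true) ∧
    (∃ x ∈ multipoleClasses b p, classExp b p x = -(N : ℤ)))

/-- net exponents along the class of `x`, in increasing position (the TYPE of the class; `x̄ = conjClass b p x` carries the reversed list). -/
def levelVec (b : ℕ → ℤ) (p x : ℕ) : List ℤ := ((classSet b p x).sort (· ≤ ·)).map (netExp b)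

/-- same orbit-type: centre flags agree and the level vectors agree (up to reversal for a conjugate pair of non-centre classes). -/
def sameKey (u v : Bool × List ℤ) : Bool := (u.1 == v.1) && (u.2 == v.2 || (!u.1 && u.2 == v.2.reverse))

/-- number of equivalence classes of `sameKey` in a list (count the last occurrences). -/
def keyCount : List (Bool × List ℤ) → ℕ
  | [] => 0
  | u :: us => (if us.any (fun v => sameKey u v) then 0 else 1) + keyCount us

/-- the deep classes whose orbit vector is not STRUCTURALLY zero (zero: non-centre, `N` even, palindromic type, since `P_T = (1 + (-1)^(N+1)) σ_T`). -/
def ccLive (b : ℕ → ℤ) (p N : ℕ) : List ℕ :=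
  ((deepClasses b p N).sort (· ≤ ·)).filter fun x =>
    !(!decide (CentreIn b p x) && N % 2 == 0 && levelVec b p x == (levelVec b p x).reverse)

/-- census count `k` = number of non-vanishing deep orbit-types. -/
def ccCount (b : ℕ → ℤ) (p N : ℕ) : ℕ := keyCount ((ccLive b p N).map fun x => (decide (CentreIn b p x), levelVec b p x))

/-- rung O guard: regime of `CollinearityCriterion`, `3 ≤ N`, and `k ≤ 1` (line through the origin) or (`N` odd, `k = 2`, moment range: affine line). -/
def ccGuard (b : ℕ → ℤ) (p N : ℕ) : Bool :=
  ccRegime b p N && decide (3 ≤ N) &&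
    (decide (ccCount b p N ≤ 1) || (N % 2 == 1 && ccCount b p N == 2 && decide (((N : ℤ) - 1) * p + 2 ≤ 2 * dOf b + 3)))

/-- rung X guard: regime of `CollinearityCriterionT`, `3 ≤ N`, `k ≤ 1` (through-origin case only). -/
def ccGuardT (b : ℕ → ℤ) (p N : ℕ) : Bool := ccRegimeT b p N && decide (3 ≤ N) && decide (ccCount b p N ≤ 1)

/-! ## §2  `sameKey` is an equivalence relation; `keyCount` counts representatives -/

/-- `sameKey` is reflexive. -/
theorem sameKey_refl (u : Bool × List ℤ) : sameKey u u = true := by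
  simp [sameKey]

/-- `sameKey` is symmetric. -/
theorem sameKey_symm {u v : Bool × List ℤ} (h : sameKey u v = true) : sameKey v u = true := by
  obtain ⟨u1, u2⟩ := u
  obtain ⟨v1, v2⟩ := v
  simp only [sameKey, Bool.and_eq_true, Bool.or_eq_true, beq_iff_eq, Bool.not_eq_true'] at h ⊢
  obtain ⟨h1, h2⟩ := h
  refine ⟨h1.symm, ?_⟩
  rcases h2 with h2 | ⟨hf, h2⟩
  · exact Or.inl h2.symm
  · exact Or.inr ⟨h1 ▸ hf, by rw [h2, List.reverse_reverse]⟩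

/-- `sameKey` is transitive. -/
theorem sameKey_trans {u v w : Bool × List ℤ} (huv : sameKey u v = true) (hvw : sameKey v w = true) : sameKey u w = true := by
  obtain ⟨u1, u2⟩ := u
  obtain ⟨v1, v2⟩ := v
  obtain ⟨w1, w2⟩ := w
  simp only [sameKey, Bool.and_eq_true, Bool.or_eq_true, beq_iff_eq, Bool.not_eq_true'] at huv hvw ⊢
  obtain ⟨h1, h2⟩ := huv
  obtain ⟨h3, h4⟩ := hvw
  refine ⟨h1.trans h3, ?_⟩
  rcases h2 with h2 | ⟨hf, h2⟩ <;> rcases h4 with h4 | ⟨hf', h4⟩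
  · exact Or.inl (h2.trans h4)
  · exact Or.inr ⟨h1 ▸ hf', h2.trans h4⟩
  · exact Or.inr ⟨hf, by rw [h2, h4]⟩
  · exact Or.inl (by rw [h2, h4, List.reverse_reverse])

/-- **`keyCount` counts a system of representatives**: there is a sublist of `keyCount l` representatives to which every element is `sameKey`-related. -/
theorem keyCount_cover (l : List (Bool × List ℤ)) :
    ∃ reps : List (Bool × List ℤ), reps.length = keyCount l ∧ (∀ r ∈ reps, r ∈ l) ∧ ∀ w ∈ l, ∃ r ∈ reps, sameKey w r = true := by
  induction l with
  | nil => exact ⟨[], rfl, fun r hr => by simp at hr, fun w hw => by simp at hw⟩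
  | cons u us ih =>
    obtain ⟨reps, hlen, hsub, hcov⟩ := ih
    by_cases hany : us.any (fun v => sameKey u v) = true
    · refine ⟨reps, ?_, fun r hr => List.mem_cons_of_mem _ (hsub r hr), ?_⟩
      · simp only [keyCount, hany, if_true, zero_add, hlen]
      · intro w hw
        rcases List.mem_cons.1 hw with rfl | hw
        · obtain ⟨v, hv, huv⟩ := List.any_eq_true.1 hany
          obtain ⟨r, hr, hvr⟩ := hcov v hv
          exact ⟨r, hr, sameKey_trans huv hvr⟩
        · exact hcov w hw
    · refine ⟨u :: reps, ?_, ?_, ?_⟩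
      · simp only [keyCount, hany, List.length_cons, hlen]; simp
        omega
      · intro r hr
        rcases List.mem_cons.1 hr with rfl | hr
        · exact List.mem_cons_self
        · exact List.mem_cons_of_mem _ (hsub r hr)
      · intro w hw
        rcases List.mem_cons.1 hw with rfl | hw
        · exact ⟨w, List.mem_cons_self, sameKey_refl w⟩
        · obtain ⟨r, hr, hwr⟩ := hcov w hw
          exact ⟨r, List.mem_cons_of_mem _ hr, hwr⟩

/-- `keyCount l ≤ 1`: all elements of `l` are pairwise `sameKey`-related. -/
theorem sameKey_of_keyCount_le_one {l : List (Bool × List ℤ)} (h : keyCount l ≤ 1) :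
    ∀ u ∈ l, ∀ v ∈ l, sameKey u v = true := by
  obtain ⟨reps, hlen, -, hcov⟩ := keyCount_cover l
  intro u hu v hv
  obtain ⟨r, hr, hur⟩ := hcov u hu
  obtain ⟨r', hr', hvr⟩ := hcov v hv
  have h1 : reps.length ≤ 1 := by omega
  have hrr : r = r' := by
    obtain ⟨i, hi, rfl⟩ := List.getElem_of_mem hr
    obtain ⟨i', hi', rfl⟩ := List.getElem_of_mem hr'
    have : i = i' := by omega
    subst this; rfl
  exact sameKey_trans hur (sameKey_symm (hrr ▸ hvr))

/-- `keyCount l = 2`: two representatives in `l` cover `l`. -/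
theorem cover_two_of_keyCount_eq_two {l : List (Bool × List ℤ)} (h : keyCount l = 2) :
    ∃ r₁ ∈ l, ∃ r₂ ∈ l, ∀ w ∈ l, sameKey w r₁ = true ∨ sameKey w r₂ = true := by
  obtain ⟨reps, hlen, hsub, hcov⟩ := keyCount_cover l
  rw [h] at hlen
  match reps, hlen with
  | [r₁, r₂], _ =>
    refine ⟨r₁, hsub r₁ (by simp), r₂, hsub r₂ (by simp), fun w hw => ?_⟩
    obtain ⟨r, hr, hwr⟩ := hcov w hw
    simp only [List.mem_cons, List.not_mem_nil, or_false] at hr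
    rcases hr with rfl | rfl
    · exact Or.inl hwr
    · exact Or.inr hwr

/-! ## §3  The exponent vector of a level class, and membership in `ccLive` -/

section Level

variable {p : ℕ} [hp : Fact p.Prime] (b : ℕ → ℤ) {x L : ℕ} (hx : x < p) (hL : x + L * p ≤ (b 0).toNat)
  (hL' : (b 0).toNat < x + L * p + p)
include hx hL hL'

/-- The sorted class of a level class is the increasing list `[x, x+p, …, x+Lp]`. -/
theorem sort_classSet_level : (classSet b p x).sort (· ≤ ·) = (List.range (L + 1)).map (fun k => x + k * p) := by
  have hp0 : 0 < p := hp.out.pos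
  have hcl := classSet_level b hx hL hL'
  refine (Finset.sortedLT_sort _).eq_of_mem_iff
    ((List.pairwise_lt_range.map (fun k => x + k * p)
      (fun a c h => Nat.add_lt_add_left (Nat.mul_lt_mul_of_pos_right h hp0) x)).sortedLT) ?_
  intro s
  rw [Finset.mem_sort, hcl, Finset.mem_image, List.mem_map]
  constructor
  · rintro ⟨k, hk, hks⟩
    exact ⟨k, List.mem_range.2 (Finset.mem_range.1 hk), hks⟩
  · rintro ⟨k, hk, hks⟩
    exact ⟨k, Finset.mem_range.2 (List.mem_range.1 hk), hks⟩

/-- **The level vector of a level class is `[netExp(x + kp)]_{k ≤ L}`** (so `levelVec = expVector`, cf. `expVector_level`). -/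
theorem levelVec_level : levelVec b p x = (List.range (L + 1)).map (fun k => netExp b (x + k * p)) := by
  unfold levelVec
  rw [sort_classSet_level b hx hL hL', List.map_map]
  rfl

end Level

/-- Membership in `ccLive`: a deep class that is NOT (non-centre with `N` even and palindromic level vector). -/
theorem mem_ccLive_iff {b : ℕ → ℤ} {p N x : ℕ} :
    x ∈ ccLive b p N ↔ x ∈ deepClasses b p N ∧
      ¬ (¬ CentreIn b p x ∧ N % 2 = 0 ∧ levelVec b p x = (levelVec b p x).reverse) := by
  unfold ccLive
  rw [List.mem_filter, Finset.mem_sort]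
  simp only [Bool.not_eq_true', Bool.and_eq_false_iff, Bool.not_eq_false', decide_eq_true_eq, beq_eq_false_iff_ne,
    ne_eq]
  tauto

end Summit.KontsevichZagierPeriods.Zeta5Search.ClusterValuation
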